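import Literature.MathematicalPhysics.QuantumFieldTheory.Balaban1983to89.B1Eq324BenfattoKernelSect5Eq515
import Literature.MathematicalPhysics.QuantumFieldTheory.Balaban1983to89.B1Eq324BenfattoSect5PavementStep
import HarnessLib

/-!
# `Balaban1983to89.B1Eq324BenfattoKernelSect5PavementStep` — [BenfattoEtAl1978] §5 pp. 155–159, ONE FULL PAVEMENT STEP of the proof of the Basic
# Lemma, (5.9)/(5.11) → (5.13)/(5.15) → [per-box (5.16)–(5.33), hypotheses] → (5.34)/(5.35), FOR THE CLASS of [Balaban1985BackgroundPropagators]
# Sect. E p. 428 — the loop closes with ONE product measure (the part fields), PROVED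

statement-level skeleton of published theorems with citation tags; proofs where landed; nothing here is a claim about the
Yang–Mills mass gap

WHY THIS MODULE (cell `pub-ymgap`, seat `dag-n08-d` gen 13, INTENT-54; node N08 [Balaban1985UV3]; the [BenfattoEtAl1978] source chain behind the
(α)-row `h324`).  The concrete `…Sect5PavementStep.pavementStep` (this seat, gen 9) chains one step of print's lower bound under [2]'s free field:
(5.11), the factorised lower bound (5.15) by the EXACT Markov property, per-box lower bounds (hypotheses), and the way back (5.35) — again by the exact
Markov property, read backwards, with the (5.34) error.  For the class the Markov property is the temperature-zero comparison of `…KernelSect5Eq515`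
(p609780): going DOWN costs `e^{−(ρ+T/2)}` (`integral_cutoff_exp_hatH_ge`), coming back UP costs `e^{−(ρ+T/2)}` again (`integral_boxes_factorise_le`,
read backwards) — and both directions meet the SAME per-box measures, the part fields `N^K_{□,ξ}` of the sub-precisions `A|_□` (the design point of this
seat's gen-12 note: a ±-temperature substitute would not close this loop; the temperature-zero one does).  So the class step reads: per-box lower bounds
`e^{ℓ_□}·∫ χ^{Γ₁(□)}_{γb}χ^□_b e^{Ψ′₁+Ψ₂} dN^K_{□,ξ} ≤ ∫ χ^{Γ₁(□)}_{γb}χ^□_b e^{Ψ_□} dN^K_{□,ξ}` (HYPOTHESES, for `ξ` on the corridor event — the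
shape the per-box line instantiates: n08-c's port map row «PerBoxAtPavement») ⟹
`exp(−err₅₁₁ − err₅₃₄ − 2(ρ + T/2) + Σ_□ℓ_□)·∫ Π_Δχ̂^{γb}_Δ e^{H^{A|Γ̄₁}_{J∩Γ̄₁}} dμ_K ≤ ∫ Π_Δχ̂^b_Δ e^{H^A_J} dμ_K` — print's «the same structure as (5.12) with J
replaced by Γ̄₁ and b by γb», for the class, at the price `2(ρ + T/2)` per step (|B|-extensive and `e^{−κw/2}`-small by seat n08-w5's
`…ClassCrossRowMass`, p608964).

OBJECTS (all displayed; no definition is made): as in `…KernelSect5Eq515` (class kernel `hK`; `μ_K`; parts of `Λ ∖ Γ₁`, labelling `π`/`hπ`;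
part-kernel rows `hKb`, `hKout`; cross-row rows `hr`, `hrmax`, `hγr`; centre row `hu`; budget row `hT`) plus the inner-corridor width `v ≤ w`, the family
`B ⊇ J.image (boxIndex L)` and §5's `Ψ′₁`, `Ψ₂`, `Γ̄₁ = corridorsBar L w v B`, `restrictCoef` (`…Sect5Eq524/534`, `…Sect5Iteration`).

WHAT IS PROVED (standard axioms; no `sorry`; no definition).
* §1 KERNEL-FREE POINTWISE STEPS (any configuration `z`): `exp_neg_err511_mul_cutoffBoltzmann_hatH_le` ((5.9)+(5.11):
  `e^{−err₅₁₁}·Π_Δχ̂_Δe^{Ĥ_J} ≤ Π_Δχ̂_Δe^{H_J}`), `exp_neg_err534_mul_cutoffBoltzmann_corridorsBar_le` ((5.33)–(5.35):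
  `e^{−err₅₃₄}·Π_Δχ̂^{γb}_Δ e^{H_{Γ̄₁}} ≤ χ^{Γ₁}_{γb}e^{H_{Γ₁}}·χ^{out}_b·Π_□(χ^{Γ₁(□)}_{γb}χ^□_b e^{Ψ′₁+Ψ₂})`) — the pointwise halves of
  `…Sect5PavementStep.exp_neg_mul_integral_cutoff_hatH_le` and `…Sect5Eq535.exp_neg_err_mul_integral_cutoff_corridorsBar_le`, exported for every measure.
* §2 under `μ_K`: `exp_neg_mul_integral_cutoff_hatH_le` ((5.11) integrated), `integrable_boxes_integrand` (the §5 product integrand is `μ_K`-integrable),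
  `boxFactor_eq_setIntegral` (on the corridor event a part-field box factor is the set integral `∫_{χ^□_b} e^{W} dN^K_{□,ξ}`),
  `integrable_partIntegrals` (the factorised `ξ`-integrand with part fields is measurable, bounded, `μ_K`-integrable — file (A)'s
  `stronglyMeasurable_integral_shift`).
* §3 ★★ `exp_neg_err_mul_integral_cutoff_corridorsBar_le` — CLASS (5.35): `e^{−err₅₃₄ − (ρ+T/2)}·∫ Π_Δχ̂^{γb}_Δ e^{H_{Γ̄₁}} dμ_K ≤
  ∫ χ^{Γ₁}_{γb}(ξ)e^{H_{Γ₁}(ξ)}·[∫χ^{out}_b dN^K_{out,ξ}]·Π_□[∫ χ^{Γ₁(□)}_{γb}χ^□_b e^{Ψ′₁+Ψ₂} dN^K_{□,ξ}] dμ_K(ξ)`;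
  ★★★ `pavementStep` — ONE FULL STEP FOR THE CLASS (statement above); `pavementStep_of_setIntegral` — the same with the per-box hypotheses in the
  set-integral form of the per-box line (port-map row «PerBoxAtPavement»).
HONEST SCOPE.  Assembly over p609780/p609197 and the kernel-free §5 algebra of this seat's gen-8/9 modules; the class, the substitute for (5.13) and the
bounded-fluctuation device are OURS (a reading of [Balaban1985BackgroundPropagators] p. 428 for [Balaban1982Higgs1] p. 616), not print; the per-box bounds
(hence `ℓ_□`) are hypotheses; the displaced-pavement chain, the class-carrying translation `K ∘ (+σ_k)`, `b*` and the upper chain are NOT here; nothing of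
[Balaban1985UV3] / [Balaban1985UV2] is asserted; no generalised Basic Lemma is stated; the port is not commissioned and nothing beyond this step is chained;
count-neutral for N08; nothing about d = 4, the continuum, OS axioms, a mass gap or the Clay problem.
-/

noncomputable section

open MeasureTheory ProbabilityTheory Finset Matrix WithLp
open scoped BigOperators Matrix NNReal ENNReal

namespace Literature.MathematicalPhysics.QuantumFieldTheory.Balaban1983to89.B1Eq324BenfattoKernelSect5PavementStep

open Literature.MathematicalPhysics.QuantumFieldTheory
open Literature.MathematicalPhysics.QuantumFieldTheory.GaussianToolkit
open Literature.MathematicalPhysics.QuantumFieldTheory.Balaban1983to89.B1Eq324BenfattoLemma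
open Literature.MathematicalPhysics.QuantumFieldTheory.Balaban1983to89.B1Eq324BenfattoKernelRegression
open Literature.MathematicalPhysics.QuantumFieldTheory.Balaban1983to89.B1Eq324BenfattoKernelOfPrecision
open Literature.MathematicalPhysics.QuantumFieldTheory.Balaban1983to89.B1Eq324BenfattoKernelCondField
open Literature.MathematicalPhysics.QuantumFieldTheory.Balaban1983to89.B1Eq324BenfattoKernelSect5Eq513
open Literature.MathematicalPhysics.QuantumFieldTheory.Balaban1983to89.B1Eq324BenfattoKernelSect5Eq515
open Literature.MathematicalPhysics.QuantumFieldTheory.Balaban1983to89.B1Eq324BenfattoClassAppendixC (posDef_of_coercive)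
open Literature.MathematicalPhysics.QuantumFieldTheory.Balaban1983to89.B1Eq324BenfattoAppendixA (distToRegion_nonneg)
open Literature.MathematicalPhysics.QuantumFieldTheory.Balaban1983to89.B1Eq324BenfattoSect5Boxes
open Literature.MathematicalPhysics.QuantumFieldTheory.Balaban1983to89.B1Eq324BenfattoSect5Eq511 (s1Const abs_Hl_le_of_range)
open Literature.MathematicalPhysics.QuantumFieldTheory.Balaban1983to89.B1Eq324BenfattoSect5Eq524 (psi1p psi2)
open Literature.MathematicalPhysics.QuantumFieldTheory.Balaban1983to89.B1Eq324BenfattoSect5Eq534 (corridorsBar abs_hamiltonian_corridorsBar_sub_sum_psi_le)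
open Literature.MathematicalPhysics.QuantumFieldTheory.Balaban1983to89.B1Eq324BenfattoSect5Eq535 (abs_psi1p_add_psi2_le_local psi1p_add_psi2_congr_eqOn measurable_psi1p_add_psi2
  mem_smallFieldOn_of_mem_smallFieldSet)
open Literature.MathematicalPhysics.QuantumFieldTheory.Balaban1983to89.B1Eq324BenfattoSect5Iteration (restrictCoef cutoffBoltzmann_hamiltonian_eq_restrict measurable_cutoffBoltzmann_hamiltonian)
open Literature.MathematicalPhysics.QuantumFieldTheory.Balaban1983to89.B1Eq324BenfattoSect5PavementStep (abs_cutoffBoltzmann_hamiltonian_le)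
open Literature.MathematicalPhysics.QuantumFieldTheory.Balaban1983to89.B1Eq324BenfattoSect5Eq515
open Literature.MathematicalPhysics.QuantumFieldTheory.Balaban1983to89.B1Eq324BenfattoSect5SlotMoments (distToRegion_eq_zero_of_mem)

variable {d : ℕ}

/-! ## §1  Kernel-free pointwise steps: (5.9)+(5.11), and (5.33)–(5.35) backwards with the (5.34) error -/

section Pointwise

variable {s D : ℕ} {κ : ℝ} {a : Coef d} {J I : Finset (B1Eq324BenfattoLemma.Site d)} {L w v : ℕ} {B : Finset (B1Eq324BenfattoLemma.Site d)} {γ b Ac : ℝ}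

/-- **(5.9) + (5.11), pointwise**: on every configuration, `e^{−err₅₁₁}·Π_Δχ̂_Δ(z)e^{Ĥ_J(z)} ≤ Π_Δχ̂_Δ(z)e^{H_J(z)}`, `err₅₁₁ = s₁A_cb^De^{−(ϰ/4)w}|J|`
(`H_J = Ĥ_J + H^{(l)} ≥ Ĥ_J − |H^{(l)}|` on the small-field set, `…Sect5Eq511.abs_Hl_le_of_range`; `L ≥ 1`, `B ⊇` the tesserae meeting `J`).
[cite: BenfattoEtAl1978, (5.9), (5.11)–(5.12) p.155] -/
theorem exp_neg_err511_mul_cutoffBoltzmann_hatH_le (hκ : 0 < κ) (hJ : CoefSupportedIn a J) (hAc0 : 0 ≤ Ac)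
    (hAc : ∀ p ∈ Finset.Icc 1 s, ∀ (Δ : Fin p → B1Eq324BenfattoLemma.Site d), (∀ i, Δ i ∈ J) →
      ∀ n ∈ admissible p D, |a p Δ n| ≤ Ac)
    (hJI : J ⊆ I) (hL : 0 < L) (hB : J.image (boxIndex L) ⊆ B) (hb : 1 ≤ b) (z : B1Eq324BenfattoLemma.Site d → ℝ) :
    Real.exp (-(s1Const s D d κ * Ac * b ^ D * Real.exp (-(κ / 4 * w)) * J.card)) * cutoffBoltzmann (hatH s D κ a L w B) I b z ≤
      cutoffBoltzmann (hamiltonian s D κ a J) I b z := by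
  simp only [cutoffBoltzmann]
  by_cases hz : z ∈ smallFieldSet I b
  swap
  · rw [Set.indicator_of_notMem hz, Set.indicator_of_notMem hz, mul_zero]
  rw [Set.indicator_of_mem hz, Set.indicator_of_mem hz, ← Real.exp_add, Real.exp_le_exp]
  have hzJ : ∀ x ∈ J, |z x| ≤ b := fun x hx => by
    have h := hz x
    rwa [distToRegion_eq_zero_of_mem (hJI hx), add_zero, mul_one] at h
  have h511 := abs_Hl_le_of_range hκ hJ hAc0 hAc hL hB hb hzJ (s := s) (D := D) (w := w)
  have hsplit := hamiltonian_eq_hatH_add_Hl s D κ a J L w B z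
  have := (abs_le.mp h511).1
  linarith

/-- **(5.33)–(5.35) backwards, pointwise**: on every configuration,
`e^{−err₅₃₄}·Π_Δχ̂^{γb}_Δ(z) e^{H_{Γ̄₁}(z)} ≤ χ^{Γ₁}_{γb}(z)e^{H_{Γ₁}(z)}·χ^{out}_b(z)·Π_{□∈B}(χ^{Γ₁(□)}_{γb}(z)χ^□_b(z) e^{(Ψ′₁+Ψ₂)(z)})`,
`err₅₃₄ = s₁A_cb^D(e^{−(ϰ/4)w}|Γ̄₁| + e^{−(ϰ/4)v}|B|L^d)`: on `Π_Δχ̂^{γb}_Δ` every regional cut-off is `1` and `H_{Γ₁} + Σ_□(Ψ′₁+Ψ₂) ≥ H_{Γ̄₁} − err₅₃₄`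
(`…Sect5Eq534.abs_hamiltonian_corridorsBar_sub_sum_psi_le`; `v ≤ w`, `γ ≤ 1 ≤ b`). [cite: BenfattoEtAl1978, §5 (5.33)–(5.35) p.159] -/
theorem exp_neg_err534_mul_cutoffBoltzmann_corridorsBar_le (hκ : 0 < κ) (hJ : CoefSupportedIn a J) (hAc0 : 0 ≤ Ac)
    (hAc : ∀ p ∈ Finset.Icc 1 s, ∀ (Δ : Fin p → B1Eq324BenfattoLemma.Site d), (∀ i, Δ i ∈ J) →
      ∀ n ∈ admissible p D, |a p Δ n| ≤ Ac)
    (hJI : J ⊆ I) (hL : 0 < L) (hv : v ≤ w) (B : Finset (B1Eq324BenfattoLemma.Site d)) (hγ1 : γ ≤ 1) (hb : 1 ≤ b) (z : B1Eq324BenfattoLemma.Site d → ℝ) :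
    Real.exp (-(s1Const s D d κ * Ac * b ^ D *
          (Real.exp (-(κ / 4 * w)) * (corridorsBar L w v B).card + Real.exp (-(κ / 4 * v)) * (B.card * (L : ℝ) ^ d)))) *
        cutoffBoltzmann (hamiltonian s D κ a (corridorsBar L w v B)) I (γ * b) z ≤
      (smallFieldOn (corridors L w B : Set (B1Eq324BenfattoLemma.Site d)) I (γ * b)).indicator (fun _ => (1 : ℝ)) z *
          Real.exp (hamiltonian s D κ a (corridors L w B) z) *
        ((smallFieldOn (out L B) I b).indicator (fun _ => (1 : ℝ)) z *
          ∏ m ∈ B, (smallFieldOn (frame1 L w m : Set (B1Eq324BenfattoLemma.Site d)) I (γ * b)).indicator (fun _ => (1 : ℝ)) z *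
              (smallFieldOn (shrink L m w : Set (B1Eq324BenfattoLemma.Site d)) I b).indicator (fun _ => (1 : ℝ)) z * Real.exp (psi1p s D κ a L w v m z + psi2 s D κ a L w m z)) := by
  have hb0 : (0 : ℝ) ≤ b := zero_le_one.trans hb
  have hγb : γ * b ≤ b := by nlinarith
  by_cases hz : z ∈ smallFieldSet I (γ * b)
  swap
  · rw [cutoffBoltzmann, Set.indicator_of_notMem hz, mul_zero]
    refine mul_nonneg (mul_nonneg (indicator_smallFieldOn_mem_Icc _ I _ z).1 (Real.exp_pos _).le)
      (mul_nonneg (indicator_smallFieldOn_mem_Icc _ I _ z).1 (Finset.prod_nonneg fun m _ => ?_))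
    exact mul_nonneg (mul_nonneg (indicator_smallFieldOn_mem_Icc _ I _ z).1 (indicator_smallFieldOn_mem_Icc _ I _ z).1) (Real.exp_pos _).le
  have i1 : z ∈ smallFieldOn (corridors L w B : Set (B1Eq324BenfattoLemma.Site d)) I (γ * b) := mem_smallFieldOn_of_mem_smallFieldSet le_rfl hz
  have i2 : z ∈ smallFieldOn (out L B) I b := mem_smallFieldOn_of_mem_smallFieldSet hγb hz
  have i3 : ∀ m : B1Eq324BenfattoLemma.Site d, z ∈ smallFieldOn (frame1 L w m : Set (B1Eq324BenfattoLemma.Site d)) I (γ * b) :=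
    fun m => mem_smallFieldOn_of_mem_smallFieldSet le_rfl hz
  have i4 : ∀ m : B1Eq324BenfattoLemma.Site d, z ∈ smallFieldOn (shrink L m w : Set (B1Eq324BenfattoLemma.Site d)) I b :=
    fun m => mem_smallFieldOn_of_mem_smallFieldSet hγb hz
  rw [cutoffBoltzmann, Set.indicator_of_mem hz, Set.indicator_of_mem i1, Set.indicator_of_mem i2, one_mul, one_mul]
  simp only [Set.indicator_of_mem (i3 _), Set.indicator_of_mem (i4 _), one_mul]
  rw [← Real.exp_sum, ← Real.exp_add, ← Real.exp_add, Real.exp_le_exp]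
  have hzJ : ∀ x ∈ J, |z x| ≤ b := fun x hx => by
    have h := hz x
    rw [distToRegion_eq_zero_of_mem (hJI hx), add_zero, mul_one] at h
    exact h.trans hγb
  have h534 := abs_hamiltonian_corridorsBar_sub_sum_psi_le hκ hJ hAc0 hAc hL hv hb hzJ (B := B) (s := s) (D := D)
  have := (abs_le.mp h534).2
  linarith

end Pointwise

/-! ## §2  Under the class field `μ_K`: (5.11) integrated; integrability of the §5 integrands -/

section Light

variable {Λ : Finset (B1Eq324BenfattoLemma.Site d)} {A : Matrix Λ Λ ℝ}
  {K : B1Eq324BenfattoLemma.Site d → B1Eq324BenfattoLemma.Site d → ℝ}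
  (hK : ∀ x y, K x y = if h : x ∈ Λ ∧ y ∈ Λ then (A⁻¹ : Matrix Λ Λ ℝ) ⟨x, h.1⟩ ⟨y, h.2⟩ else 0)
  {s D : ℕ} {κ : ℝ} {a : Coef d} {J I : Finset (B1Eq324BenfattoLemma.Site d)} {L w : ℕ} {B : Finset (B1Eq324BenfattoLemma.Site d)} {γ b Ac : ℝ}

include hK

/-- **(5.9) + (5.11) under the class field**: `e^{−err₅₁₁}·∫ Π_Δχ̂_Δ e^{Ĥ_J} dμ_K ≤ ∫ Π_Δχ̂_Δ e^{H_J} dμ_K` (§1 pointwise + monotonicity; `μ_K` a probability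
measure for a positive-definite `A`). [cite: BenfattoEtAl1978, (5.9), (5.11)–(5.12) p.155 (class form)] -/
theorem exp_neg_mul_integral_cutoff_hatH_le (hA : A.PosDef) (hκ : 0 < κ) (hJ : CoefSupportedIn a J) (hAc0 : 0 ≤ Ac)
    (hAc : ∀ p ∈ Finset.Icc 1 s, ∀ (Δ : Fin p → B1Eq324BenfattoLemma.Site d), (∀ i, Δ i ∈ J) →
      ∀ n ∈ admissible p D, |a p Δ n| ≤ Ac)
    (hJI : J ⊆ I) (hL : 0 < L) (hB : J.image (boxIndex L) ⊆ B) (hb : 1 ≤ b) :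
    Real.exp (-(s1Const s D d κ * Ac * b ^ D * Real.exp (-(κ / 4 * w)) * J.card)) *
        ∫ z, cutoffBoltzmann (hatH s D κ a L w B) I b z ∂gaussianFieldOfKernel K ≤
      ∫ z, cutoffBoltzmann (hamiltonian s D κ a J) I b z ∂gaussianFieldOfKernel K := by
  haveI : IsProbabilityMeasure (gaussianFieldOfKernel K) := isProbabilityMeasure_gaussianFieldOfKernel (isPosSemidefKernel_kernel hK hA)
  rw [← integral_const_mul]
  have hint : Integrable (fun z => cutoffBoltzmann (hamiltonian s D κ a J) I b z) (gaussianFieldOfKernel K) := by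
    refine Integrable.of_bound (measurable_cutoffBoltzmann_hamiltonian a J I b).aestronglyMeasurable
      (Real.exp (s1Const s D d κ * Ac * b ^ D * J.card)) (ae_of_all _ fun z => ?_)
    rw [Real.norm_eq_abs]
    exact abs_cutoffBoltzmann_hamiltonian_le hκ hJ hAc0 hAc hJI hb z
  refine integral_mono_of_nonneg (Filter.Eventually.of_forall fun z => mul_nonneg (Real.exp_pos _).le ?_) hint
    (Filter.Eventually.of_forall fun z => exp_neg_err511_mul_cutoffBoltzmann_hatH_le hκ hJ hAc0 hAc hJI hL hB hb z)
  rw [cutoffBoltzmann]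
  exact Set.indicator_nonneg (fun _ _ => (Real.exp_pos _).le) _

/-- **The §5 product integrand is `μ_K`-integrable** (bounded by `e^{s₁A_cb^D|Γ₁|}·Π_□e^{K_W}`, measurable) — the class twin of
`…Sect5Eq515.integrable_boxes_integrand`. [cite: BenfattoEtAl1978, (5.13) p.155 (class form)] -/
theorem integrable_boxes_integrand (hA : A.PosDef) (hκ : 0 < κ) (hJ : CoefSupportedIn a J) (hAc0 : 0 ≤ Ac)
    (hAc : ∀ p ∈ Finset.Icc 1 s, ∀ (Δ : Fin p → B1Eq324BenfattoLemma.Site d), (∀ i, Δ i ∈ J) →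
      ∀ n ∈ admissible p D, |a p Δ n| ≤ Ac)
    (hJI : J ⊆ I) (B : Finset (B1Eq324BenfattoLemma.Site d)) (hγ1 : γ ≤ 1) (hb : 1 ≤ b)
    (W : B1Eq324BenfattoLemma.Site d → (B1Eq324BenfattoLemma.Site d → ℝ) → ℝ) (hWm : ∀ m, Measurable (W m)) {KW : ℝ}
    (hWb : ∀ m, ∀ z : B1Eq324BenfattoLemma.Site d → ℝ, (∀ x ∈ J, x ∈ box L m → |z x| ≤ b) → |W m z| ≤ KW) :
    Integrable (fun z : B1Eq324BenfattoLemma.Site d → ℝ => (smallFieldOn (corridors L w B : Set (B1Eq324BenfattoLemma.Site d)) I (γ * b)).indicator (fun _ => (1 : ℝ)) z *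
          Real.exp (hamiltonian s D κ a (corridors L w B) z) *
        ((smallFieldOn (out L B) I b).indicator (fun _ => (1 : ℝ)) z *
          ∏ m ∈ B, (smallFieldOn (frame1 L w m : Set (B1Eq324BenfattoLemma.Site d)) I (γ * b)).indicator (fun _ => (1 : ℝ)) z *
              (smallFieldOn (shrink L m w : Set (B1Eq324BenfattoLemma.Site d)) I b).indicator (fun _ => (1 : ℝ)) z * Real.exp (W m z))) (gaussianFieldOfKernel K) := by
  haveI : IsProbabilityMeasure (gaussianFieldOfKernel K) := isProbabilityMeasure_gaussianFieldOfKernel (isPosSemidefKernel_kernel hK hA)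
  refine Integrable.of_bound ?_ (Real.exp (s1Const s D d κ * Ac * b ^ D * (corridors L w B).card) * (1 * ∏ _m ∈ B, Real.exp KW))
    (ae_of_all _ fun z => ?_)
  · refine (((measurable_indicator_smallFieldOn _ I (γ * b)).mul (measurable_hamiltonian _).exp).mul
      ((measurable_indicator_smallFieldOn _ I b).mul (Finset.measurable_prod _ fun m _ => ?_))).aestronglyMeasurable
    exact ((measurable_indicator_smallFieldOn _ I (γ * b)).mul (measurable_indicator_smallFieldOn _ I b)).mul (hWm m).exp
  · rw [Real.norm_eq_abs, abs_mul]
    refine mul_le_mul (abs_corridorObs_le hκ hJ hAc0 hAc hJI hγ1 hb _ z) ?_ (abs_nonneg _) (Real.exp_pos _).le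
    rw [abs_mul, Finset.abs_prod]
    refine mul_le_mul ?_ (Finset.prod_le_prod (fun m _ => abs_nonneg _)
      fun m _ => abs_boxObs_le hJI hγ1 (zero_le_one.trans hb) m (hWb m) z) (Finset.prod_nonneg fun m _ => abs_nonneg _) zero_le_one
    rw [abs_of_nonneg (indicator_smallFieldOn_mem_Icc _ I b z).1]
    exact (indicator_smallFieldOn_mem_Icc _ I b z).2

/-- **THE FACTORISED `ξ`-INTEGRAND WITH PART FIELDS IS `μ_K`-INTEGRABLE**: for per-box weights `W_□` measurable and bounded on the cut-offs' support,
`ξ ↦ χ^{Γ₁}_{γb}(ξ)e^{H_{Γ₁}(ξ)}·[∫χ^{out}_b dN^K_{out,ξ}]·Π_□[∫ χ^{Γ₁(□)}_{γb}χ^□_b e^{W_□} dN^K_{□,ξ}]` is measurable (file (A)'s `stronglyMeasurable_integral_shift`)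
and bounded by `e^{s₁A_cb^D|Γ₁|}·Π_□e^{K_W}` (the part fields are probability measures). [cite: BenfattoEtAl1978, §5 (5.13)–(5.15) p.155 (class form)] -/
theorem integrable_partIntegrals (hA : A.PosDef) (hκ : 0 < κ) (hJ : CoefSupportedIn a J) (hAc0 : 0 ≤ Ac)
    (hAc : ∀ p ∈ Finset.Icc 1 s, ∀ (Δ : Fin p → B1Eq324BenfattoLemma.Site d), (∀ i, Δ i ∈ J) →
      ∀ n ∈ admissible p D, |a p Δ n| ≤ Ac)
    (hJI : J ⊆ I) (hγ1 : γ ≤ 1) (hb : 1 ≤ b) (hBΛ : ∀ m ∈ B, box L m ⊆ Λ)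
    {Kb : B1Eq324BenfattoLemma.Site d → B1Eq324BenfattoLemma.Site d → B1Eq324BenfattoLemma.Site d → ℝ}
    (hKb : ∀ m (hm : m ∈ B) x y, Kb m x y = if h : x ∈ shrink L m w ∧ y ∈ shrink L m w then
      ((A.submatrix (fun j : ↥(shrink L m w) => (⟨j, hBΛ m hm (shrink_subset_box L m w j.2)⟩ : Λ))
        (fun j : ↥(shrink L m w) => (⟨j, hBΛ m hm (shrink_subset_box L m w j.2)⟩ : Λ)))⁻¹ :
          Matrix ↥(shrink L m w) ↥(shrink L m w) ℝ) ⟨x, h.1⟩ ⟨y, h.2⟩ else 0)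
    {Kout : B1Eq324BenfattoLemma.Site d → B1Eq324BenfattoLemma.Site d → ℝ}
    (hKout : ∀ x y, Kout x y =
      if h : x ∈ ((Λ \ corridors L w B).filter fun x => ∀ m ∈ B, x ∉ box L m) ∧
          y ∈ ((Λ \ corridors L w B).filter fun x => ∀ m ∈ B, x ∉ box L m) then
        ((A.submatrix
            (fun j : ↥((Λ \ corridors L w B).filter fun x => ∀ m ∈ B, x ∉ box L m) =>
              (⟨j, (Finset.mem_sdiff.mp (Finset.mem_filter.mp j.2).1).1⟩ : Λ))
            (fun j : ↥((Λ \ corridors L w B).filter fun x => ∀ m ∈ B, x ∉ box L m) =>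
              (⟨j, (Finset.mem_sdiff.mp (Finset.mem_filter.mp j.2).1).1⟩ : Λ)))⁻¹ :
          Matrix ↥((Λ \ corridors L w B).filter fun x => ∀ m ∈ B, x ∉ box L m)
            ↥((Λ \ corridors L w B).filter fun x => ∀ m ∈ B, x ∉ box L m) ℝ) ⟨x, h.1⟩ ⟨y, h.2⟩ else 0)
    (W : B1Eq324BenfattoLemma.Site d → (B1Eq324BenfattoLemma.Site d → ℝ) → ℝ) (hWm : ∀ m, Measurable (W m)) {KW : ℝ}
    (hWb : ∀ m, ∀ z : B1Eq324BenfattoLemma.Site d → ℝ, (∀ x ∈ J, x ∈ box L m → |z x| ≤ b) → |W m z| ≤ KW) :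
    Integrable (fun ξ : B1Eq324BenfattoLemma.Site d → ℝ => (smallFieldOn (corridors L w B : Set (B1Eq324BenfattoLemma.Site d)) I (γ * b)).indicator (fun _ => (1 : ℝ)) ξ *
          Real.exp (hamiltonian s D κ a (corridors L w B) ξ) *
        ((∫ z, (smallFieldOn (out L B) I b).indicator (fun _ => (1 : ℝ)) z ∂((gaussianFieldOfKernel Kout).map
              fun (ζ : B1Eq324BenfattoLemma.Site d → ℝ) (x : B1Eq324BenfattoLemma.Site d) => condMean K (corridors L w B) ξ x + ζ x)) *
          ∏ m ∈ B, ∫ z, (smallFieldOn (frame1 L w m : Set (B1Eq324BenfattoLemma.Site d)) I (γ * b)).indicator (fun _ => (1 : ℝ)) z *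
              (smallFieldOn (shrink L m w : Set (B1Eq324BenfattoLemma.Site d)) I b).indicator (fun _ => (1 : ℝ)) z * Real.exp (W m z) ∂((gaussianFieldOfKernel (Kb m)).map
              fun (ζ : B1Eq324BenfattoLemma.Site d → ℝ) (x : B1Eq324BenfattoLemma.Site d) => condMean K (corridors L w B) ξ x + ζ x))) (gaussianFieldOfKernel K) ∧
    ∀ ξ : B1Eq324BenfattoLemma.Site d → ℝ, 0 ≤ (smallFieldOn (corridors L w B : Set (B1Eq324BenfattoLemma.Site d)) I (γ * b)).indicator (fun _ => (1 : ℝ)) ξ *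
          Real.exp (hamiltonian s D κ a (corridors L w B) ξ) *
        ((∫ z, (smallFieldOn (out L B) I b).indicator (fun _ => (1 : ℝ)) z ∂((gaussianFieldOfKernel Kout).map
              fun (ζ : B1Eq324BenfattoLemma.Site d → ℝ) (x : B1Eq324BenfattoLemma.Site d) => condMean K (corridors L w B) ξ x + ζ x)) *
          ∏ m ∈ B, ∫ z, (smallFieldOn (frame1 L w m : Set (B1Eq324BenfattoLemma.Site d)) I (γ * b)).indicator (fun _ => (1 : ℝ)) z *
              (smallFieldOn (shrink L m w : Set (B1Eq324BenfattoLemma.Site d)) I b).indicator (fun _ => (1 : ℝ)) z * Real.exp (W m z) ∂((gaussianFieldOfKernel (Kb m)).map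
              fun (ζ : B1Eq324BenfattoLemma.Site d → ℝ) (x : B1Eq324BenfattoLemma.Site d) => condMean K (corridors L w B) ξ x + ζ x)) := by
  classical
  have hb0 : 0 ≤ b := zero_le_one.trans hb
  have hKpsd : IsPosSemidefKernel K := isPosSemidefKernel_kernel hK hA
  haveI : IsProbabilityMeasure (gaussianFieldOfKernel K) := isProbabilityMeasure_gaussianFieldOfKernel hKpsd
  have hPDout : (A.submatrix
      (fun j : ↥((Λ \ corridors L w B).filter fun x => ∀ m ∈ B, x ∉ box L m) =>
        (⟨j, (Finset.mem_sdiff.mp (Finset.mem_filter.mp j.2).1).1⟩ : Λ))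
      (fun j : ↥((Λ \ corridors L w B).filter fun x => ∀ m ∈ B, x ∉ box L m) =>
        (⟨j, (Finset.mem_sdiff.mp (Finset.mem_filter.mp j.2).1).1⟩ : Λ))).PosDef :=
    hA.submatrix fun a b hab => Subtype.ext (by simpa using congrArg Subtype.val hab)
  have hKoutpsd : IsPosSemidefKernel Kout := isPosSemidefKernel_kernel hKout hPDout
  haveI : IsProbabilityMeasure (gaussianFieldOfKernel Kout) := isProbabilityMeasure_gaussianFieldOfKernel hKoutpsd
  have hKbpsd : ∀ m (hm : m ∈ B), IsPosSemidefKernel (Kb m) := fun m hm =>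
    isPosSemidefKernel_kernel (hKb m hm) (hA.submatrix fun a b hab => Subtype.ext (by simpa using congrArg Subtype.val hab))
  have hfar0 : ∀ ξ : B1Eq324BenfattoLemma.Site d → ℝ, 0 ≤ ∫ z, (smallFieldOn (out L B) I b).indicator (fun _ => (1 : ℝ)) z ∂((gaussianFieldOfKernel Kout).map
              fun (ζ : B1Eq324BenfattoLemma.Site d → ℝ) (x : B1Eq324BenfattoLemma.Site d) => condMean K (corridors L w B) ξ x + ζ x) := fun ξ =>
    integral_nonneg fun z => (indicator_smallFieldOn_mem_Icc _ I b z).1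
  have hbox0 : ∀ (ξ : B1Eq324BenfattoLemma.Site d → ℝ) (m : B1Eq324BenfattoLemma.Site d), 0 ≤ ∫ z, (smallFieldOn (frame1 L w m : Set (B1Eq324BenfattoLemma.Site d)) I (γ * b)).indicator (fun _ => (1 : ℝ)) z *
              (smallFieldOn (shrink L m w : Set (B1Eq324BenfattoLemma.Site d)) I b).indicator (fun _ => (1 : ℝ)) z * Real.exp (W m z) ∂((gaussianFieldOfKernel (Kb m)).map
              fun (ζ : B1Eq324BenfattoLemma.Site d → ℝ) (x : B1Eq324BenfattoLemma.Site d) => condMean K (corridors L w B) ξ x + ζ x) := fun ξ m =>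
    integral_nonneg fun z => mul_nonneg (mul_nonneg (indicator_smallFieldOn_mem_Icc _ I _ z).1 (indicator_smallFieldOn_mem_Icc _ I _ z).1)
      (Real.exp_pos _).le
  refine ⟨?_, fun ξ => mul_nonneg (mul_nonneg (indicator_smallFieldOn_mem_Icc _ I _ ξ).1 (Real.exp_pos _).le)
    (mul_nonneg (hfar0 ξ) (Finset.prod_nonneg fun m _ => hbox0 ξ m))⟩
  have hLm : Measurable fun ξ : B1Eq324BenfattoLemma.Site d → ℝ => (smallFieldOn (corridors L w B : Set (B1Eq324BenfattoLemma.Site d)) I (γ * b)).indicator (fun _ => (1 : ℝ)) ξ *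
          Real.exp (hamiltonian s D κ a (corridors L w B) ξ) *
        ((∫ z, (smallFieldOn (out L B) I b).indicator (fun _ => (1 : ℝ)) z ∂((gaussianFieldOfKernel Kout).map
              fun (ζ : B1Eq324BenfattoLemma.Site d → ℝ) (x : B1Eq324BenfattoLemma.Site d) => condMean K (corridors L w B) ξ x + ζ x)) *
          ∏ m ∈ B, ∫ z, (smallFieldOn (frame1 L w m : Set (B1Eq324BenfattoLemma.Site d)) I (γ * b)).indicator (fun _ => (1 : ℝ)) z *
              (smallFieldOn (shrink L m w : Set (B1Eq324BenfattoLemma.Site d)) I b).indicator (fun _ => (1 : ℝ)) z * Real.exp (W m z) ∂((gaussianFieldOfKernel (Kb m)).map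
              fun (ζ : B1Eq324BenfattoLemma.Site d → ℝ) (x : B1Eq324BenfattoLemma.Site d) => condMean K (corridors L w B) ξ x + ζ x)) := by
    refine ((measurable_indicator_smallFieldOn _ I (γ * b)).mul (measurable_hamiltonian _).exp).mul
      ((stronglyMeasurable_integral_shift K (corridors L w B) (gaussianFieldOfKernel Kout)
        (measurable_indicator_smallFieldOn _ I b)).measurable.mul (Finset.measurable_prod _ fun m hm => ?_))
    haveI : IsProbabilityMeasure (gaussianFieldOfKernel (Kb m)) := isProbabilityMeasure_gaussianFieldOfKernel (hKbpsd m hm)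
    exact (stronglyMeasurable_integral_shift K (corridors L w B) (gaussianFieldOfKernel (Kb m))
      (((measurable_indicator_smallFieldOn _ I (γ * b)).mul (measurable_indicator_smallFieldOn _ I b)).mul (hWm m).exp)).measurable
  refine Integrable.of_bound hLm.aestronglyMeasurable
    (Real.exp (s1Const s D d κ * Ac * b ^ D * (corridors L w B).card) * (1 * ∏ _m ∈ B, Real.exp KW)) (ae_of_all _ fun ξ => ?_)
  haveI : IsProbabilityMeasure ((gaussianFieldOfKernel Kout).map
              fun (ζ : B1Eq324BenfattoLemma.Site d → ℝ) (x : B1Eq324BenfattoLemma.Site d) => condMean K (corridors L w B) ξ x + ζ x) :=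
    Measure.isProbabilityMeasure_map (measurable_shift _).aemeasurable
  rw [Real.norm_eq_abs, abs_mul]
  refine mul_le_mul (abs_corridorObs_le hκ hJ hAc0 hAc hJI hγ1 hb _ ξ) ?_ (abs_nonneg _) (Real.exp_pos _).le
  rw [abs_mul, Finset.abs_prod]
  refine mul_le_mul ?_ (Finset.prod_le_prod (fun m _ => abs_nonneg _) fun m hm => ?_)
    (Finset.prod_nonneg fun m _ => abs_nonneg _) zero_le_one
  · have h := norm_integral_le_of_norm_le_const (μ := ((gaussianFieldOfKernel Kout).map
              fun (ζ : B1Eq324BenfattoLemma.Site d → ℝ) (x : B1Eq324BenfattoLemma.Site d) => condMean K (corridors L w B) ξ x + ζ x))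
      (f := fun z : B1Eq324BenfattoLemma.Site d → ℝ => (smallFieldOn (out L B) I b).indicator (fun _ => (1 : ℝ)) z) (C := 1)
      (ae_of_all _ fun z => by
        rw [Real.norm_eq_abs, abs_of_nonneg (indicator_smallFieldOn_mem_Icc _ I b z).1]
        exact (indicator_smallFieldOn_mem_Icc _ I b z).2)
    rwa [Real.norm_eq_abs, probReal_univ, mul_one] at h
  · haveI : IsProbabilityMeasure (gaussianFieldOfKernel (Kb m)) := isProbabilityMeasure_gaussianFieldOfKernel (hKbpsd m hm)
    haveI : IsProbabilityMeasure ((gaussianFieldOfKernel (Kb m)).map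
              fun (ζ : B1Eq324BenfattoLemma.Site d → ℝ) (x : B1Eq324BenfattoLemma.Site d) => condMean K (corridors L w B) ξ x + ζ x) :=
      Measure.isProbabilityMeasure_map (measurable_shift _).aemeasurable
    have h := norm_integral_le_of_norm_le_const (μ := ((gaussianFieldOfKernel (Kb m)).map
              fun (ζ : B1Eq324BenfattoLemma.Site d → ℝ) (x : B1Eq324BenfattoLemma.Site d) => condMean K (corridors L w B) ξ x + ζ x))
      (f := fun z : B1Eq324BenfattoLemma.Site d → ℝ => (smallFieldOn (frame1 L w m : Set (B1Eq324BenfattoLemma.Site d)) I (γ * b)).indicator (fun _ => (1 : ℝ)) z *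
              (smallFieldOn (shrink L m w : Set (B1Eq324BenfattoLemma.Site d)) I b).indicator (fun _ => (1 : ℝ)) z * Real.exp (W m z)) (C := Real.exp KW)
      (ae_of_all _ fun z => by
        rw [Real.norm_eq_abs]
        exact abs_boxObs_le hJI hγ1 hb0 m (hWb m) z)
    rwa [Real.norm_eq_abs, probReal_univ, mul_one] at h



/-- **On the corridor event a part-field box factor is a set integral**: for `□_m ∈ B`, `ξ` with `χ^{Γ₁}_{γb}(ξ) = 1` and any weight `W`,
`∫ χ^{Γ₁(□)}_{γb}(z)χ^□_b(z)e^{W(z)} dN^K_{□,ξ}(z) = ∫_{χ^□_b} e^{W} dN^K_{□,ξ}` — under the part field the corridor coordinates are `ξ`'s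
(file (A) `partField_ae_eqOn`), so `χ^{Γ₁(□)}_{γb}(z) = χ^{Γ₁(□)}_{γb}(ξ) = 1` a.s.; the class twin of `…Sect5PavementStep.boxFactor_eq_setIntegral`
(the form in which the per-box line states its factors). [cite: BenfattoEtAl1978, (5.13)–(5.15) p.155 (class form)] -/
theorem boxFactor_eq_setIntegral (hA : A.PosDef) (hΓΛ : corridors L w B ⊆ Λ) (hBΛ : ∀ m ∈ B, box L m ⊆ Λ) (hL : 0 < L)
    {Kb : B1Eq324BenfattoLemma.Site d → B1Eq324BenfattoLemma.Site d → B1Eq324BenfattoLemma.Site d → ℝ}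
    (hKb : ∀ m (hm : m ∈ B) x y, Kb m x y = if h : x ∈ shrink L m w ∧ y ∈ shrink L m w then
      ((A.submatrix (fun j : ↥(shrink L m w) => (⟨j, hBΛ m hm (shrink_subset_box L m w j.2)⟩ : Λ))
        (fun j : ↥(shrink L m w) => (⟨j, hBΛ m hm (shrink_subset_box L m w j.2)⟩ : Λ)))⁻¹ :
          Matrix ↥(shrink L m w) ↥(shrink L m w) ℝ) ⟨x, h.1⟩ ⟨y, h.2⟩ else 0)
    {m : B1Eq324BenfattoLemma.Site d} (hm : m ∈ B) (W : (B1Eq324BenfattoLemma.Site d → ℝ) → ℝ) {ξ : B1Eq324BenfattoLemma.Site d → ℝ}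
    (hξ : ξ ∈ smallFieldOn (corridors L w B : Set (B1Eq324BenfattoLemma.Site d)) I (γ * b)) :
    ∫ z, (smallFieldOn (frame1 L w m : Set (B1Eq324BenfattoLemma.Site d)) I (γ * b)).indicator (fun _ => (1 : ℝ)) z *
              (smallFieldOn (shrink L m w : Set (B1Eq324BenfattoLemma.Site d)) I b).indicator (fun _ => (1 : ℝ)) z * Real.exp (W z) ∂((gaussianFieldOfKernel (Kb m)).map
              fun (ζ : B1Eq324BenfattoLemma.Site d → ℝ) (x : B1Eq324BenfattoLemma.Site d) => condMean K (corridors L w B) ξ x + ζ x)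
      = ∫ z in smallFieldOn (shrink L m w : Set (B1Eq324BenfattoLemma.Site d)) I b, Real.exp (W z) ∂((gaussianFieldOfKernel (Kb m)).map
              fun (ζ : B1Eq324BenfattoLemma.Site d → ℝ) (x : B1Eq324BenfattoLemma.Site d) => condMean K (corridors L w B) ξ x + ζ x) := by
  have hsub : (frame1 L w m : Set (B1Eq324BenfattoLemma.Site d)) ⊆ (corridors L w B : Set (B1Eq324BenfattoLemma.Site d)) :=
    Finset.coe_subset.mpr (frame1_subset_corridors L w hm)
  have hξ1 : ξ ∈ smallFieldOn (frame1 L w m : Set (B1Eq324BenfattoLemma.Site d)) I (γ * b) := smallFieldOn_mono hsub I (γ * b) hξ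
  rw [← integral_indicator (measurableSet_smallFieldOn _ I b)]
  refine integral_congr_ae ?_
  filter_upwards [partField_ae_eqOn hK hA hΓΛ (shrink_subset_sdiff_corridors hL hBΛ hm) (hKb m hm) ξ] with z hz
  have hz1 : z ∈ smallFieldOn (frame1 L w m : Set (B1Eq324BenfattoLemma.Site d)) I (γ * b) := by
    intro x hx
    rw [hz x (Finset.mem_coe.mp (hsub hx))]
    exact hξ1 x hx
  rw [Set.indicator_of_mem hz1, one_mul]
  by_cases hzS : z ∈ smallFieldOn (shrink L m w : Set (B1Eq324BenfattoLemma.Site d)) I b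
  · rw [Set.indicator_of_mem hzS, Set.indicator_of_mem hzS, one_mul]
  · rw [Set.indicator_of_notMem hzS, Set.indicator_of_notMem hzS, zero_mul]

end Light

/-! ## §3  Class (5.35) and ONE FULL PAVEMENT STEP for the class -/

section Main

variable {Λ : Finset (B1Eq324BenfattoLemma.Site d)} {A : Matrix Λ Λ ℝ}
  {K : B1Eq324BenfattoLemma.Site d → B1Eq324BenfattoLemma.Site d → ℝ}
  (hK : ∀ x y, K x y = if h : x ∈ Λ ∧ y ∈ Λ then (A⁻¹ : Matrix Λ Λ ℝ) ⟨x, h.1⟩ ⟨y, h.2⟩ else 0)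
  {s D : ℕ} {κ : ℝ} {a : Coef d} {J I : Finset (B1Eq324BenfattoLemma.Site d)} {L w v : ℕ} {B : Finset (B1Eq324BenfattoLemma.Site d)}
  {γ b Ac : ℝ}
  (hAs : ∀ e e', A e e' = A e' e) {γA rmax : ℝ} (hγA0 : 0 < γA)
  (hγA : ∀ x : Λ → ℝ, γA * ∑ e, x e ^ 2 ≤ ∑ e, ∑ e', A e e' * x e * x e')
  (hJI : J ⊆ I) (hL : 0 < L) (hγ1 : γ ≤ 1) (hb : 1 ≤ b)
  (hΓΛ : corridors L w B ⊆ Λ) (hBΛ : ∀ m ∈ B, box L m ⊆ Λ)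
  (π : ↥(Λ \ corridors L w B) → Option ↥B)
  (hπ : ∀ (y : ↥(Λ \ corridors L w B)) (m : ↥B), π y = some m ↔ (y : B1Eq324BenfattoLemma.Site d) ∈ shrink L (m : B1Eq324BenfattoLemma.Site d) w)
  (r : ↥(Λ \ corridors L w B) → ℝ)
  (hr : ∀ y : ↥(Λ \ corridors L w B), ∑ y' : ↥(Λ \ corridors L w B), (if π y = π y' then (0 : ℝ) else
    |A ⟨y, (Finset.mem_sdiff.mp y.2).1⟩ ⟨y', (Finset.mem_sdiff.mp y'.2).1⟩|) ≤ r y)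
  (hrmax : ∀ y, r y ≤ rmax) (hγr : rmax < γA)
  {Kb : B1Eq324BenfattoLemma.Site d → B1Eq324BenfattoLemma.Site d → B1Eq324BenfattoLemma.Site d → ℝ}
  (hKb : ∀ m (hm : m ∈ B) x y, Kb m x y = if h : x ∈ shrink L m w ∧ y ∈ shrink L m w then
    ((A.submatrix (fun j : ↥(shrink L m w) => (⟨j, hBΛ m hm (shrink_subset_box L m w j.2)⟩ : Λ))
      (fun j : ↥(shrink L m w) => (⟨j, hBΛ m hm (shrink_subset_box L m w j.2)⟩ : Λ)))⁻¹ :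
        Matrix ↥(shrink L m w) ↥(shrink L m w) ℝ) ⟨x, h.1⟩ ⟨y, h.2⟩ else 0)
  {Kout : B1Eq324BenfattoLemma.Site d → B1Eq324BenfattoLemma.Site d → ℝ}
  (hKout : ∀ x y, Kout x y =
    if h : x ∈ ((Λ \ corridors L w B).filter fun x => ∀ m ∈ B, x ∉ box L m) ∧
        y ∈ ((Λ \ corridors L w B).filter fun x => ∀ m ∈ B, x ∉ box L m) then
      ((A.submatrix
          (fun j : ↥((Λ \ corridors L w B).filter fun x => ∀ m ∈ B, x ∉ box L m) =>
            (⟨j, (Finset.mem_sdiff.mp (Finset.mem_filter.mp j.2).1).1⟩ : Λ))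
          (fun j : ↥((Λ \ corridors L w B).filter fun x => ∀ m ∈ B, x ∉ box L m) =>
            (⟨j, (Finset.mem_sdiff.mp (Finset.mem_filter.mp j.2).1).1⟩ : Λ)))⁻¹ :
        Matrix ↥((Λ \ corridors L w B).filter fun x => ∀ m ∈ B, x ∉ box L m)
          ↥((Λ \ corridors L w B).filter fun x => ∀ m ∈ B, x ∉ box L m) ℝ) ⟨x, h.1⟩ ⟨y, h.2⟩ else 0)
  {Cu : ℝ}
  (hu : ∀ ξ ∈ smallFieldOn (corridors L w B : Set (B1Eq324BenfattoLemma.Site d)) I (γ * b),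
    ∀ y ∈ Λ \ corridors L w B, |condMean K (corridors L w B) ξ y| ≤ Cu * b * (1 + distToRegion I y))
  {T : ℝ} (hT : (1 + Cu) ^ 2 * b ^ 2 * ∑ y : ↥(Λ \ corridors L w B), r y * (1 + distToRegion I y) ^ 2 ≤ T)

include hK hAs hγA0 hγA hJI hL hγ1 hb hΓΛ hBΛ hπ hr hrmax hγr hKb hKout hu hT

/-- **CLASS (5.35) — «USE THE MARKOV PROPERTY», BACKWARDS, WITH THE ERROR OF (5.34)**, the exact Markov property replaced by the comparison of
`…KernelSect5Eq515.integral_boxes_factorise_le`: with the per-box weights `W_□ = Ψ′₁ + Ψ₂`,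
`e^{−err₅₃₄ − (ρ + T/2)}·∫ Π_Δχ̂^{γb}_Δ e^{H_{Γ̄₁}} dμ_K ≤ ∫ χ^{Γ₁}_{γb}(ξ)e^{H_{Γ₁}(ξ)}·[∫χ^{out}_b dN^K_{out,ξ}]·Π_{□∈B}[∫ χ^{Γ₁(□)}_{γb}χ^□_b e^{Ψ′₁+Ψ₂} dN^K_{□,ξ}] dμ_K(ξ)`
(`v ≤ w`, `γ ≤ 1 ≤ b`, `J ⊆ I`).  The free-field statement replaced is `…Sect5Eq535.exp_neg_err_mul_integral_cutoff_corridorsBar_le`.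
[cite: BenfattoEtAl1978, §5 (5.34)–(5.35) p.159 (class substitute at temperature zero; ours)] -/
theorem exp_neg_err_mul_integral_cutoff_corridorsBar_le (hκ : 0 < κ) (hJ : CoefSupportedIn a J) (hAc0 : 0 ≤ Ac)
    (hAc : ∀ p ∈ Finset.Icc 1 s, ∀ (Δ : Fin p → B1Eq324BenfattoLemma.Site d), (∀ i, Δ i ∈ J) →
      ∀ n ∈ admissible p D, |a p Δ n| ≤ Ac) (hv : v ≤ w) :
    Real.exp (-(s1Const s D d κ * Ac * b ^ D *
          (Real.exp (-(κ / 4 * w)) * (corridorsBar L w v B).card + Real.exp (-(κ / 4 * v)) * (B.card * (L : ℝ) ^ d))) - ((∑ y, r y) / (γA - rmax) + T / 2)) *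
        ∫ z, cutoffBoltzmann (hamiltonian s D κ a (corridorsBar L w v B)) I (γ * b) z ∂gaussianFieldOfKernel K ≤
      ∫ ξ, (smallFieldOn (corridors L w B : Set (B1Eq324BenfattoLemma.Site d)) I (γ * b)).indicator (fun _ => (1 : ℝ)) ξ *
          Real.exp (hamiltonian s D κ a (corridors L w B) ξ) *
        ((∫ z, (smallFieldOn (out L B) I b).indicator (fun _ => (1 : ℝ)) z ∂((gaussianFieldOfKernel Kout).map
              fun (ζ : B1Eq324BenfattoLemma.Site d → ℝ) (x : B1Eq324BenfattoLemma.Site d) => condMean K (corridors L w B) ξ x + ζ x)) *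
          ∏ m ∈ B, ∫ z, (smallFieldOn (frame1 L w m : Set (B1Eq324BenfattoLemma.Site d)) I (γ * b)).indicator (fun _ => (1 : ℝ)) z *
              (smallFieldOn (shrink L m w : Set (B1Eq324BenfattoLemma.Site d)) I b).indicator (fun _ => (1 : ℝ)) z * Real.exp (psi1p s D κ a L w v m z + psi2 s D κ a L w m z) ∂((gaussianFieldOfKernel (Kb m)).map
              fun (ζ : B1Eq324BenfattoLemma.Site d → ℝ) (x : B1Eq324BenfattoLemma.Site d) => condMean K (corridors L w B) ξ x + ζ x)) ∂gaussianFieldOfKernel K := by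
  classical
  have hA : A.PosDef := posDef_of_coercive hAs hγA0 hγA
  haveI : IsProbabilityMeasure (gaussianFieldOfKernel K) := isProbabilityMeasure_gaussianFieldOfKernel (isPosSemidefKernel_kernel hK hA)
  have hWb : ∀ m, ∀ z : B1Eq324BenfattoLemma.Site d → ℝ, (∀ x ∈ J, x ∈ box L m → |z x| ≤ b) →
      |psi1p s D κ a L w v m z + psi2 s D κ a L w m z| ≤ 8 * (s1Const s D d κ * Ac * b ^ D * (L : ℝ) ^ d) :=
    fun m z hz => abs_psi1p_add_psi2_le_local hκ hJ hAc0 hAc hb hz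
  -- (5.13) backwards, for the class
  have hup := integral_boxes_factorise_le hK hAs hγA0 hγA hJI hL hγ1 hb hΓΛ hBΛ π hπ r hr hrmax hγr hKb hKout hu hT hκ hJ hAc0 hAc (fun m z => psi1p s D κ a L w v m z + psi2 s D κ a L w m z)
    (fun m z z' h => psi1p_add_psi2_congr_eqOn L w v m h) (fun m => measurable_psi1p_add_psi2 L w v m) hWb
  -- the pointwise (5.33)–(5.35), integrated against `μ_K`
  have hgi := integrable_boxes_integrand hK hA hκ hJ hAc0 hAc hJI B hγ1 hb (L := L) (w := w)
    (fun m z => psi1p s D κ a L w v m z + psi2 s D κ a L w m z) (fun m => measurable_psi1p_add_psi2 L w v m) hWb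
  have hpt : Real.exp (-(s1Const s D d κ * Ac * b ^ D *
          (Real.exp (-(κ / 4 * w)) * (corridorsBar L w v B).card + Real.exp (-(κ / 4 * v)) * (B.card * (L : ℝ) ^ d)))) *
        ∫ z, cutoffBoltzmann (hamiltonian s D κ a (corridorsBar L w v B)) I (γ * b) z ∂gaussianFieldOfKernel K ≤
      ∫ z, (smallFieldOn (corridors L w B : Set (B1Eq324BenfattoLemma.Site d)) I (γ * b)).indicator (fun _ => (1 : ℝ)) z *
          Real.exp (hamiltonian s D κ a (corridors L w B) z) *
        ((smallFieldOn (out L B) I b).indicator (fun _ => (1 : ℝ)) z *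
          ∏ m ∈ B, (smallFieldOn (frame1 L w m : Set (B1Eq324BenfattoLemma.Site d)) I (γ * b)).indicator (fun _ => (1 : ℝ)) z *
              (smallFieldOn (shrink L m w : Set (B1Eq324BenfattoLemma.Site d)) I b).indicator (fun _ => (1 : ℝ)) z * Real.exp (psi1p s D κ a L w v m z + psi2 s D κ a L w m z)) ∂gaussianFieldOfKernel K := by
    rw [← integral_const_mul]
    refine integral_mono_of_nonneg (Filter.Eventually.of_forall fun z => mul_nonneg (Real.exp_pos _).le ?_) hgi
      (Filter.Eventually.of_forall fun z => exp_neg_err534_mul_cutoffBoltzmann_corridorsBar_le hκ hJ hAc0 hAc hJI hL hv B hγ1 hb z)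
    rw [cutoffBoltzmann]
    exact Set.indicator_nonneg (fun _ _ => (Real.exp_pos _).le) _
  have hZ0 : 0 ≤ ∫ z, cutoffBoltzmann (hamiltonian s D κ a (corridorsBar L w v B)) I (γ * b) z ∂gaussianFieldOfKernel K :=
    integral_nonneg fun z => by
      rw [cutoffBoltzmann]
      exact Set.indicator_nonneg (fun _ _ => (Real.exp_pos _).le) _
  -- chain: e^{−err−ρ′}·Z ≤ e^{−ρ′}·(unfactorised form) ≤ e^{−ρ′}·e^{ρ′}·(factorised form)
  have key : Real.exp (-((∑ y, r y) / (γA - rmax) + T / 2)) * (Real.exp ((∑ y, r y) / (γA - rmax) + T / 2) *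
      ∫ ξ, (smallFieldOn (corridors L w B : Set (B1Eq324BenfattoLemma.Site d)) I (γ * b)).indicator (fun _ => (1 : ℝ)) ξ *
          Real.exp (hamiltonian s D κ a (corridors L w B) ξ) *
        ((∫ z, (smallFieldOn (out L B) I b).indicator (fun _ => (1 : ℝ)) z ∂((gaussianFieldOfKernel Kout).map
              fun (ζ : B1Eq324BenfattoLemma.Site d → ℝ) (x : B1Eq324BenfattoLemma.Site d) => condMean K (corridors L w B) ξ x + ζ x)) *
          ∏ m ∈ B, ∫ z, (smallFieldOn (frame1 L w m : Set (B1Eq324BenfattoLemma.Site d)) I (γ * b)).indicator (fun _ => (1 : ℝ)) z *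
              (smallFieldOn (shrink L m w : Set (B1Eq324BenfattoLemma.Site d)) I b).indicator (fun _ => (1 : ℝ)) z * Real.exp (psi1p s D κ a L w v m z + psi2 s D κ a L w m z) ∂((gaussianFieldOfKernel (Kb m)).map
              fun (ζ : B1Eq324BenfattoLemma.Site d → ℝ) (x : B1Eq324BenfattoLemma.Site d) => condMean K (corridors L w B) ξ x + ζ x)) ∂gaussianFieldOfKernel K) =
      ∫ ξ, (smallFieldOn (corridors L w B : Set (B1Eq324BenfattoLemma.Site d)) I (γ * b)).indicator (fun _ => (1 : ℝ)) ξ *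
          Real.exp (hamiltonian s D κ a (corridors L w B) ξ) *
        ((∫ z, (smallFieldOn (out L B) I b).indicator (fun _ => (1 : ℝ)) z ∂((gaussianFieldOfKernel Kout).map
              fun (ζ : B1Eq324BenfattoLemma.Site d → ℝ) (x : B1Eq324BenfattoLemma.Site d) => condMean K (corridors L w B) ξ x + ζ x)) *
          ∏ m ∈ B, ∫ z, (smallFieldOn (frame1 L w m : Set (B1Eq324BenfattoLemma.Site d)) I (γ * b)).indicator (fun _ => (1 : ℝ)) z *
              (smallFieldOn (shrink L m w : Set (B1Eq324BenfattoLemma.Site d)) I b).indicator (fun _ => (1 : ℝ)) z * Real.exp (psi1p s D κ a L w v m z + psi2 s D κ a L w m z) ∂((gaussianFieldOfKernel (Kb m)).map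
              fun (ζ : B1Eq324BenfattoLemma.Site d → ℝ) (x : B1Eq324BenfattoLemma.Site d) => condMean K (corridors L w B) ξ x + ζ x)) ∂gaussianFieldOfKernel K := by
    rw [← mul_assoc, ← Real.exp_add, neg_add_cancel, Real.exp_zero, one_mul]
  rw [sub_eq_add_neg, Real.exp_add, mul_assoc]
  calc Real.exp (-(s1Const s D d κ * Ac * b ^ D *
          (Real.exp (-(κ / 4 * w)) * (corridorsBar L w v B).card + Real.exp (-(κ / 4 * v)) * (B.card * (L : ℝ) ^ d)))) * (Real.exp (-((∑ y, r y) / (γA - rmax) + T / 2)) *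
        ∫ z, cutoffBoltzmann (hamiltonian s D κ a (corridorsBar L w v B)) I (γ * b) z ∂gaussianFieldOfKernel K)
      = Real.exp (-((∑ y, r y) / (γA - rmax) + T / 2)) * (Real.exp (-(s1Const s D d κ * Ac * b ^ D *
          (Real.exp (-(κ / 4 * w)) * (corridorsBar L w v B).card + Real.exp (-(κ / 4 * v)) * (B.card * (L : ℝ) ^ d)))) *
        ∫ z, cutoffBoltzmann (hamiltonian s D κ a (corridorsBar L w v B)) I (γ * b) z ∂gaussianFieldOfKernel K) := by ring
    _ ≤ Real.exp (-((∑ y, r y) / (γA - rmax) + T / 2)) *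
        ∫ z, (smallFieldOn (corridors L w B : Set (B1Eq324BenfattoLemma.Site d)) I (γ * b)).indicator (fun _ => (1 : ℝ)) z *
          Real.exp (hamiltonian s D κ a (corridors L w B) z) *
        ((smallFieldOn (out L B) I b).indicator (fun _ => (1 : ℝ)) z *
          ∏ m ∈ B, (smallFieldOn (frame1 L w m : Set (B1Eq324BenfattoLemma.Site d)) I (γ * b)).indicator (fun _ => (1 : ℝ)) z *
              (smallFieldOn (shrink L m w : Set (B1Eq324BenfattoLemma.Site d)) I b).indicator (fun _ => (1 : ℝ)) z * Real.exp (psi1p s D κ a L w v m z + psi2 s D κ a L w m z)) ∂gaussianFieldOfKernel K := mul_le_mul_of_nonneg_left hpt (Real.exp_pos _).le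
    _ ≤ Real.exp (-((∑ y, r y) / (γA - rmax) + T / 2)) * (Real.exp ((∑ y, r y) / (γA - rmax) + T / 2) *
      ∫ ξ, (smallFieldOn (corridors L w B : Set (B1Eq324BenfattoLemma.Site d)) I (γ * b)).indicator (fun _ => (1 : ℝ)) ξ *
          Real.exp (hamiltonian s D κ a (corridors L w B) ξ) *
        ((∫ z, (smallFieldOn (out L B) I b).indicator (fun _ => (1 : ℝ)) z ∂((gaussianFieldOfKernel Kout).map
              fun (ζ : B1Eq324BenfattoLemma.Site d → ℝ) (x : B1Eq324BenfattoLemma.Site d) => condMean K (corridors L w B) ξ x + ζ x)) *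
          ∏ m ∈ B, ∫ z, (smallFieldOn (frame1 L w m : Set (B1Eq324BenfattoLemma.Site d)) I (γ * b)).indicator (fun _ => (1 : ℝ)) z *
              (smallFieldOn (shrink L m w : Set (B1Eq324BenfattoLemma.Site d)) I b).indicator (fun _ => (1 : ℝ)) z * Real.exp (psi1p s D κ a L w v m z + psi2 s D κ a L w m z) ∂((gaussianFieldOfKernel (Kb m)).map
              fun (ζ : B1Eq324BenfattoLemma.Site d → ℝ) (x : B1Eq324BenfattoLemma.Site d) => condMean K (corridors L w B) ξ x + ζ x)) ∂gaussianFieldOfKernel K) := mul_le_mul_of_nonneg_left hup (Real.exp_pos _).le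
    _ = _ := key

/-- **ONE FULL PAVEMENT STEP OF THE PROOF OF THE BASIC LEMMA, FOR THE CLASS** — (5.9)/(5.11) → class (5.15) → [per-box] → class (5.35), chained:
for the class kernel `hK` of a symmetric `γ_A`-coercive `A` on `Λ ⊇` the corridors and the boxes of `B`, tesserae of side `L ≥ 1`, inner corridors of width
`v ≤ w`, `γ ≤ 1 ≤ b`, `J ⊆ I`, `B ⊇` the tesserae meeting `J`, the rows `hπ hr hrmax hγr hKb hKout hu hT` of `…KernelSect5Eq515`, the extension convention
with `|A^{n}_{Δ}| ≤ A_c` on the range of (4.5), and PER-BOX LOWER BOUNDS IN THE PART-FIELD CURRENCY (hypotheses; the per-box line's (5.16)–(5.33) on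
`N^K_{□,ξ}`): for every `□ ∈ B` and every datum `ξ` on the corridor event `χ^{Γ₁}_{γb}(ξ) = 1`,
`e^{ℓ_□}·∫ χ^{Γ₁(□)}_{γb}χ^□_b e^{Ψ′₁+Ψ₂} dN^K_{□,ξ} ≤ ∫ χ^{Γ₁(□)}_{γb}χ^□_b e^{Ψ_□} dN^K_{□,ξ}` —
`exp(−err₅₁₁ − err₅₃₄ − 2(ρ + T/2) + Σ_{□∈B}ℓ_□)·∫ Π_Δχ̂^{γb}_Δ e^{H^{A|Γ̄₁}_{J∩Γ̄₁}} dμ_K ≤ ∫ Π_Δχ̂^{b}_Δ e^{H^A_J} dμ_K`, `ρ = Σ_y r_y/(γ_A − r_max)`,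
`err₅₁₁ = s₁A_cb^De^{−(ϰ/4)w}|J|`, `err₅₃₄ = s₁A_cb^D(e^{−(ϰ/4)w}|Γ̄₁| + e^{−(ϰ/4)v}|B|L^d)`: the left side of (4.7) for `(J, I, A_c, b)` dominates, up to the
errors, TWICE the decoupling price and the accumulated per-box exponents, the left side of (4.7) for the next datum `(J ∩ Γ̄₁, I, A_c|_{Γ̄₁}, γb)` UNDER THE
SAME CLASS FIELD `μ_K`.  The free-field statement replaced is `…Sect5PavementStep.pavementStep`.
[cite: BenfattoEtAl1978, §5 (5.9)–(5.15) p.155, (5.34)–(5.35) p.159 (class substitute at temperature zero; ours)] -/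
theorem pavementStep (hκ : 0 < κ) (hJ : CoefSupportedIn a J) (hAc0 : 0 ≤ Ac)
    (hAc : ∀ p ∈ Finset.Icc 1 s, ∀ (Δ : Fin p → B1Eq324BenfattoLemma.Site d), (∀ i, Δ i ∈ J) →
      ∀ n ∈ admissible p D, |a p Δ n| ≤ Ac) (hv : v ≤ w) (hB : J.image (boxIndex L) ⊆ B)
    (ℓ : B1Eq324BenfattoLemma.Site d → ℝ)
    (hbox : ∀ m ∈ B, ∀ ξ : B1Eq324BenfattoLemma.Site d → ℝ, ξ ∈ smallFieldOn (corridors L w B : Set (B1Eq324BenfattoLemma.Site d)) I (γ * b) →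
      Real.exp (ℓ m) * ∫ z, (smallFieldOn (frame1 L w m : Set (B1Eq324BenfattoLemma.Site d)) I (γ * b)).indicator (fun _ => (1 : ℝ)) z *
              (smallFieldOn (shrink L m w : Set (B1Eq324BenfattoLemma.Site d)) I b).indicator (fun _ => (1 : ℝ)) z * Real.exp (psi1p s D κ a L w v m z + psi2 s D κ a L w m z) ∂((gaussianFieldOfKernel (Kb m)).map
              fun (ζ : B1Eq324BenfattoLemma.Site d → ℝ) (x : B1Eq324BenfattoLemma.Site d) => condMean K (corridors L w B) ξ x + ζ x)
        ≤ ∫ z, (smallFieldOn (frame1 L w m : Set (B1Eq324BenfattoLemma.Site d)) I (γ * b)).indicator (fun _ => (1 : ℝ)) z *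
              (smallFieldOn (shrink L m w : Set (B1Eq324BenfattoLemma.Site d)) I b).indicator (fun _ => (1 : ℝ)) z * Real.exp (psiBox s D κ a L w m z) ∂((gaussianFieldOfKernel (Kb m)).map
              fun (ζ : B1Eq324BenfattoLemma.Site d → ℝ) (x : B1Eq324BenfattoLemma.Site d) => condMean K (corridors L w B) ξ x + ζ x)) :
    Real.exp (-(s1Const s D d κ * Ac * b ^ D * Real.exp (-(κ / 4 * w)) * J.card)
        - s1Const s D d κ * Ac * b ^ D *
          (Real.exp (-(κ / 4 * w)) * (corridorsBar L w v B).card + Real.exp (-(κ / 4 * v)) * (B.card * (L : ℝ) ^ d))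
        - 2 * ((∑ y, r y) / (γA - rmax) + T / 2) + ∑ m ∈ B, ℓ m) *
        ∫ z, cutoffBoltzmann (hamiltonian s D κ (restrictCoef a (corridorsBar L w v B)) (J ∩ corridorsBar L w v B)) I (γ * b) z ∂gaussianFieldOfKernel K
      ≤ ∫ z, cutoffBoltzmann (hamiltonian s D κ a J) I b z ∂gaussianFieldOfKernel K := by
  classical
  have hA : A.PosDef := posDef_of_coercive hAs hγA0 hγA
  haveI : IsProbabilityMeasure (gaussianFieldOfKernel K) := isProbabilityMeasure_gaussianFieldOfKernel (isPosSemidefKernel_kernel hK hA)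
  set e511 : ℝ := s1Const s D d κ * Ac * b ^ D * Real.exp (-(κ / 4 * w)) * J.card with he511
  set e534 : ℝ := s1Const s D d κ * Ac * b ^ D *
          (Real.exp (-(κ / 4 * w)) * (corridorsBar L w v B).card + Real.exp (-(κ / 4 * v)) * (B.card * (L : ℝ) ^ d)) with he534
  set ρ' : ℝ := ((∑ y, r y) / (γA - rmax) + T / 2) with hρ'
  -- the factors of the two factorised forms
  set pre : (B1Eq324BenfattoLemma.Site d → ℝ) → ℝ := fun ξ =>
    (smallFieldOn (corridors L w B : Set (B1Eq324BenfattoLemma.Site d)) I (γ * b)).indicator (fun _ => (1 : ℝ)) ξ *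
          Real.exp (hamiltonian s D κ a (corridors L w B) ξ) with hpre
  set OUT : (B1Eq324BenfattoLemma.Site d → ℝ) → ℝ := fun ξ =>
    ∫ z, (smallFieldOn (out L B) I b).indicator (fun _ => (1 : ℝ)) z ∂((gaussianFieldOfKernel Kout).map
              fun (ζ : B1Eq324BenfattoLemma.Site d → ℝ) (x : B1Eq324BenfattoLemma.Site d) => condMean K (corridors L w B) ξ x + ζ x) with hOUT
  set F : B1Eq324BenfattoLemma.Site d → (B1Eq324BenfattoLemma.Site d → ℝ) → ℝ := fun m ξ =>
    ∫ z, (smallFieldOn (frame1 L w m : Set (B1Eq324BenfattoLemma.Site d)) I (γ * b)).indicator (fun _ => (1 : ℝ)) z *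
              (smallFieldOn (shrink L m w : Set (B1Eq324BenfattoLemma.Site d)) I b).indicator (fun _ => (1 : ℝ)) z * Real.exp (psiBox s D κ a L w m z) ∂((gaussianFieldOfKernel (Kb m)).map
              fun (ζ : B1Eq324BenfattoLemma.Site d → ℝ) (x : B1Eq324BenfattoLemma.Site d) => condMean K (corridors L w B) ξ x + ζ x) with hF
  set G : B1Eq324BenfattoLemma.Site d → (B1Eq324BenfattoLemma.Site d → ℝ) → ℝ := fun m ξ =>
    ∫ z, (smallFieldOn (frame1 L w m : Set (B1Eq324BenfattoLemma.Site d)) I (γ * b)).indicator (fun _ => (1 : ℝ)) z *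
              (smallFieldOn (shrink L m w : Set (B1Eq324BenfattoLemma.Site d)) I b).indicator (fun _ => (1 : ℝ)) z * Real.exp (psi1p s D κ a L w v m z + psi2 s D κ a L w m z) ∂((gaussianFieldOfKernel (Kb m)).map
              fun (ζ : B1Eq324BenfattoLemma.Site d → ℝ) (x : B1Eq324BenfattoLemma.Site d) => condMean K (corridors L w B) ξ x + ζ x) with hG
  have hWbΨ : ∀ m, ∀ z : B1Eq324BenfattoLemma.Site d → ℝ, (∀ x ∈ J, x ∈ box L m → |z x| ≤ b) →
      |psiBox s D κ a L w m z| ≤ 2 * s1Const s D d κ * Ac * b ^ D * (L : ℝ) ^ d := fun m z hz => abs_psiBox_le_local hκ hJ hAc0 hAc hb hz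
  -- step 1: (5.11)
  have h1 := exp_neg_mul_integral_cutoff_hatH_le hK hA hκ hJ hAc0 hAc hJI hL hB hb (s := s) (D := D) (w := w) (I := I)
  -- step 2: class (5.13) + (5.15)
  have h2 : Real.exp (-ρ') * ∫ ξ, pre ξ * (OUT ξ * ∏ m ∈ B, F m ξ) ∂gaussianFieldOfKernel K ≤
      ∫ z, cutoffBoltzmann (hatH s D κ a L w B) I b z ∂gaussianFieldOfKernel K :=
    integral_cutoff_exp_hatH_ge hK hAs hγA0 hγA hJI hL hγ1 hb hΓΛ hBΛ π hπ r hr hrmax hγr hKb hKout hu hT hκ hJ hAc0 hAc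
  -- step 3: the per-box lower bounds, inside the ξ-integral
  have hpre0 : ∀ ξ, 0 ≤ pre ξ := fun ξ => mul_nonneg (indicator_smallFieldOn_mem_Icc _ I _ ξ).1 (Real.exp_pos _).le
  have hOUT0 : ∀ ξ, 0 ≤ OUT ξ := fun ξ => integral_nonneg fun z => (indicator_smallFieldOn_mem_Icc _ I b z).1
  have hboxObs0 : ∀ (m : B1Eq324BenfattoLemma.Site d) (W : (B1Eq324BenfattoLemma.Site d → ℝ) → ℝ) (z : B1Eq324BenfattoLemma.Site d → ℝ),
      0 ≤ (smallFieldOn (frame1 L w m : Set (B1Eq324BenfattoLemma.Site d)) I (γ * b)).indicator (fun _ => (1 : ℝ)) z *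
        (smallFieldOn (shrink L m w : Set (B1Eq324BenfattoLemma.Site d)) I b).indicator (fun _ => (1 : ℝ)) z * Real.exp (W z) := fun m W z =>
    mul_nonneg (mul_nonneg (indicator_smallFieldOn_mem_Icc _ I _ z).1 (indicator_smallFieldOn_mem_Icc _ I _ z).1) (Real.exp_pos _).le
  have hG0 : ∀ m ξ, 0 ≤ G m ξ := fun m ξ =>
    integral_nonneg fun z => hboxObs0 m (fun z => psi1p s D κ a L w v m z + psi2 s D κ a L w m z) z
  have h3pt : ∀ ξ, Real.exp (∑ m ∈ B, ℓ m) * (pre ξ * (OUT ξ * ∏ m ∈ B, G m ξ)) ≤ pre ξ * (OUT ξ * ∏ m ∈ B, F m ξ) := by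
    intro ξ
    by_cases hξ : ξ ∈ smallFieldOn (corridors L w B : Set (B1Eq324BenfattoLemma.Site d)) I (γ * b)
    swap
    · have hpre : pre ξ = 0 := by
        simp only [hpre]
        rw [Set.indicator_of_notMem hξ, zero_mul]
      rw [hpre, zero_mul, zero_mul, mul_zero]
    rw [Real.exp_sum]
    have hprod : (∏ m ∈ B, Real.exp (ℓ m)) * ∏ m ∈ B, G m ξ ≤ ∏ m ∈ B, F m ξ := by
      rw [← Finset.prod_mul_distrib]
      exact Finset.prod_le_prod (fun m _ => mul_nonneg (Real.exp_pos _).le (hG0 m ξ)) fun m hm => hbox m hm ξ hξ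
    calc (∏ m ∈ B, Real.exp (ℓ m)) * (pre ξ * (OUT ξ * ∏ m ∈ B, G m ξ))
        = pre ξ * (OUT ξ * ((∏ m ∈ B, Real.exp (ℓ m)) * ∏ m ∈ B, G m ξ)) := by ring
      _ ≤ pre ξ * (OUT ξ * ∏ m ∈ B, F m ξ) :=
        mul_le_mul_of_nonneg_left (mul_le_mul_of_nonneg_left hprod (hOUT0 ξ)) (hpre0 ξ)
  have hint : Integrable (fun ξ => pre ξ * (OUT ξ * ∏ m ∈ B, F m ξ)) (gaussianFieldOfKernel K) :=
    (integrable_partIntegrals hK hA hκ hJ hAc0 hAc hJI hγ1 hb hBΛ hKb hKout (fun m z => psiBox s D κ a L w m z)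
      (fun m => measurable_psiBox L w m) hWbΨ).1
  have h3 : Real.exp (∑ m ∈ B, ℓ m) * ∫ ξ, pre ξ * (OUT ξ * ∏ m ∈ B, G m ξ) ∂gaussianFieldOfKernel K
      ≤ ∫ ξ, pre ξ * (OUT ξ * ∏ m ∈ B, F m ξ) ∂gaussianFieldOfKernel K := by
    rw [← integral_const_mul]
    exact integral_mono_of_nonneg (Filter.Eventually.of_forall fun ξ => mul_nonneg (Real.exp_pos _).le
      (mul_nonneg (hpre0 ξ) (mul_nonneg (hOUT0 ξ) (Finset.prod_nonneg fun m _ => hG0 m ξ)))) hint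
      (Filter.Eventually.of_forall h3pt)
  -- step 4: class (5.35) with the (5.34) error
  have h4 : Real.exp (-e534 - ρ') * ∫ z, cutoffBoltzmann (hamiltonian s D κ a (corridorsBar L w v B)) I (γ * b) z ∂gaussianFieldOfKernel K
      ≤ ∫ ξ, pre ξ * (OUT ξ * ∏ m ∈ B, G m ξ) ∂gaussianFieldOfKernel K :=
    exp_neg_err_mul_integral_cutoff_corridorsBar_le hK hAs hγA0 hγA hJI hL hγ1 hb hΓΛ hBΛ π hπ r hr hrmax hγr hKb hKout hu hT hκ hJ hAc0 hAc hv
  -- step 5: the next datum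
  have h5 : ∫ z, cutoffBoltzmann (hamiltonian s D κ a (corridorsBar L w v B)) I (γ * b) z ∂gaussianFieldOfKernel K
      = ∫ z, cutoffBoltzmann (hamiltonian s D κ (restrictCoef a (corridorsBar L w v B)) (J ∩ corridorsBar L w v B)) I (γ * b) z ∂gaussianFieldOfKernel K :=
    integral_congr_ae (Filter.Eventually.of_forall fun z => cutoffBoltzmann_hamiltonian_eq_restrict hJ _ I (γ * b) z)
  -- chain
  rw [← h5]
  have hexp : Real.exp (-e511 - e534 - 2 * ρ' + ∑ m ∈ B, ℓ m) =
      Real.exp (-e511) * (Real.exp (-ρ') * (Real.exp (∑ m ∈ B, ℓ m) * Real.exp (-e534 - ρ'))) := by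
    rw [← Real.exp_add, ← Real.exp_add, ← Real.exp_add]
    congr 1
    ring
  calc Real.exp (-e511 - e534 - 2 * ρ' + ∑ m ∈ B, ℓ m) * ∫ z, cutoffBoltzmann (hamiltonian s D κ a (corridorsBar L w v B)) I (γ * b) z ∂gaussianFieldOfKernel K
      = Real.exp (-e511) * (Real.exp (-ρ') * (Real.exp (∑ m ∈ B, ℓ m) * (Real.exp (-e534 - ρ') *
          ∫ z, cutoffBoltzmann (hamiltonian s D κ a (corridorsBar L w v B)) I (γ * b) z ∂gaussianFieldOfKernel K))) := by
        rw [hexp]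
        ring
    _ ≤ Real.exp (-e511) * (Real.exp (-ρ') * (Real.exp (∑ m ∈ B, ℓ m) * ∫ ξ, pre ξ * (OUT ξ * ∏ m ∈ B, G m ξ) ∂gaussianFieldOfKernel K)) :=
        mul_le_mul_of_nonneg_left (mul_le_mul_of_nonneg_left (mul_le_mul_of_nonneg_left h4 (Real.exp_pos _).le)
          (Real.exp_pos _).le) (Real.exp_pos _).le
    _ ≤ Real.exp (-e511) * (Real.exp (-ρ') * ∫ ξ, pre ξ * (OUT ξ * ∏ m ∈ B, F m ξ) ∂gaussianFieldOfKernel K) :=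
        mul_le_mul_of_nonneg_left (mul_le_mul_of_nonneg_left h3 (Real.exp_pos _).le) (Real.exp_pos _).le
    _ ≤ Real.exp (-e511) * ∫ z, cutoffBoltzmann (hatH s D κ a L w B) I b z ∂gaussianFieldOfKernel K :=
        mul_le_mul_of_nonneg_left h2 (Real.exp_pos _).le
    _ ≤ _ := h1


/-- **ONE FULL PAVEMENT STEP FOR THE CLASS, with the per-box hypotheses in SET-INTEGRAL FORM** (the shape of the per-box line's
`…Sect5PerBoxAtPavement.perBox_at_pavement`, port-map row «PerBoxAtPavement»: `e^{ℓ_□}·∫_{χ^□_b} e^{Ψ′₁+Ψ₂} dN^K_{□,ξ} ≤ ∫_{χ^□_b} e^{Ψ_□} dN^K_{□,ξ}` for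
every `□ ∈ B` and every `ξ` with `χ^{Γ₁}_{γb}(ξ) = 1`); conclusion as in `pavementStep` (`boxFactor_eq_setIntegral` both sides).
[cite: BenfattoEtAl1978, §5 (5.9)–(5.15) p.155, (5.30)–(5.35) p.158–159 (class substitute at temperature zero; ours)] -/
theorem pavementStep_of_setIntegral (hκ : 0 < κ) (hJ : CoefSupportedIn a J) (hAc0 : 0 ≤ Ac)
    (hAc : ∀ p ∈ Finset.Icc 1 s, ∀ (Δ : Fin p → B1Eq324BenfattoLemma.Site d), (∀ i, Δ i ∈ J) →
      ∀ n ∈ admissible p D, |a p Δ n| ≤ Ac) (hv : v ≤ w) (hB : J.image (boxIndex L) ⊆ B)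
    (ℓ : B1Eq324BenfattoLemma.Site d → ℝ)
    (hbox : ∀ m ∈ B, ∀ ξ : B1Eq324BenfattoLemma.Site d → ℝ, ξ ∈ smallFieldOn (corridors L w B : Set (B1Eq324BenfattoLemma.Site d)) I (γ * b) →
      Real.exp (ℓ m) * ∫ z in smallFieldOn (shrink L m w : Set (B1Eq324BenfattoLemma.Site d)) I b,
          Real.exp (psi1p s D κ a L w v m z + psi2 s D κ a L w m z) ∂((gaussianFieldOfKernel (Kb m)).map
              fun (ζ : B1Eq324BenfattoLemma.Site d → ℝ) (x : B1Eq324BenfattoLemma.Site d) => condMean K (corridors L w B) ξ x + ζ x)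
        ≤ ∫ z in smallFieldOn (shrink L m w : Set (B1Eq324BenfattoLemma.Site d)) I b,
          Real.exp (psiBox s D κ a L w m z) ∂((gaussianFieldOfKernel (Kb m)).map
              fun (ζ : B1Eq324BenfattoLemma.Site d → ℝ) (x : B1Eq324BenfattoLemma.Site d) => condMean K (corridors L w B) ξ x + ζ x)) :
    Real.exp (-(s1Const s D d κ * Ac * b ^ D * Real.exp (-(κ / 4 * w)) * J.card)
        - s1Const s D d κ * Ac * b ^ D *
          (Real.exp (-(κ / 4 * w)) * (corridorsBar L w v B).card + Real.exp (-(κ / 4 * v)) * (B.card * (L : ℝ) ^ d))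
        - 2 * ((∑ y, r y) / (γA - rmax) + T / 2) + ∑ m ∈ B, ℓ m) *
        ∫ z, cutoffBoltzmann (hamiltonian s D κ (restrictCoef a (corridorsBar L w v B)) (J ∩ corridorsBar L w v B)) I (γ * b) z ∂gaussianFieldOfKernel K
      ≤ ∫ z, cutoffBoltzmann (hamiltonian s D κ a J) I b z ∂gaussianFieldOfKernel K := by
  have hA : A.PosDef := posDef_of_coercive hAs hγA0 hγA
  refine pavementStep hK hAs hγA0 hγA hJI hL hγ1 hb hΓΛ hBΛ π hπ r hr hrmax hγr hKb hKout hu hT hκ hJ hAc0 hAc hv hB ℓ fun m hm ξ hξ => ?_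
  rw [boxFactor_eq_setIntegral hK hA hΓΛ hBΛ hL hKb hm _ hξ, boxFactor_eq_setIntegral hK hA hΓΛ hBΛ hL hKb hm _ hξ]
  exact hbox m hm ξ hξ

end Main

end Literature.MathematicalPhysics.QuantumFieldTheory.Balaban1983to89.B1Eq324BenfattoKernelSect5PavementStep

end
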